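import Summits.CriticalPhenomena.Ising3DConformalLimit.Theses.UnitLightCone
import Literature.Barriers.CriticalPhenomena.ScaleCovarianceNotMoebius

/-!
# `UnitSpeedTwoPoint` (crux stmt-CriticalPhenomena-17167, route `UnitLightCone`): the Ising input `hlim` is
# load-bearing — with `hρ`/`hlim` deleted the statement is FALSE (negative-side support, refuter cdisprove seat)

`UnitSpeedTwoPoint` claims: for every pointwise scaling limit `S` of `criticalCorr 3` (renormalisation `ρ > 0`)
that is normalised, non-degenerate, translation invariant and scale covariant with dimension `Δ`, the kernel
`x ↦ S 2 (0, x)` has unit-cone Källén–Lehmann representations in the axis frame `e₂` and in the face-diagonal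
frame.  Here we record, sorry-free:

* `lightCone_secondDifference` — a model-blind REAL-VARIABLE consequence of a unit-cone representation
  `K(w,t) = ∫ cos(k·w) e^{-ω|t|} dμ`, `μ{ω < ‖k‖} = 0`: for `0 ≤ h < t`,
  `2K(0,t) ≤ K(h e₀, t) + (K(0,t+h) + K(0,t-h))/2` (pointwise `cos(k₀h) + cosh(ωh) ≥ 2` on the cone).
* `no_unitCone_measure_for_Ksq` — no cone-carried measure represents the squashed kernel
  `(a² + b² + t²/4)^{-1/2}` (speed of light `1/2` along `e₂`): the inequality fails at `t = 1`, `h = 3/10`.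
* `unitSpeedTwoPoint_false_without_hlim` — hence the crux with the hypotheses `hρ`, `hlim` removed and everything
  else verbatim (stated inline; no proposition and no witness is defined under `Summits/`) is false: the squashed
  free field (built locally in the proof) is normalised, non-degenerate, translation invariant and scale covariant
  with `Δ = 1/2`.

Moral for provers: every proof must use the Ising input, and what it has to extract from it is two-point
ISOTROPY (the tree's `HyperoctahedralRPTwoPoint.kernel_rotation_invariant`); the remaining content is the classical
unit-cone KL representation of `C‖x‖^{-2Δ}`, `1/2 ≤ Δ ≤ 1`.  This file does NOT refute the crux.
-/

noncomputable section

namespace Summit.CriticalPhenomena.Ising3DConformalLimit.Theorems.UnitSpeedTwoPoint.Negative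

open MeasureTheory
open Literature.Probability.LatticeModels

/-- Pointwise light-cone inequality: for a spectral point `(k, ω)` inside the forward cone (`|k₀| ≤ ω`) and a
transverse displacement `h ≥ 0`, `2 e^{-ωt} ≤ cos(k₀ h) e^{-ωt} + (e^{-ω(t+h)} + e^{-ω(t-h)})/2`, i.e.
`cos(k₀h) + cosh(ωh) ≥ 2` (from `cos θ ≥ 1 - θ²/2`, `cosh θ ≥ 1 + θ²/2`, `θ² = (k₀h)² ≤ (ωh)²`). [folklore] -/
theorem pointwise_lightCone {k0 ω t : ℝ} (h : ℝ) (hk : |k0| ≤ ω) :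
    2 * Real.exp (-(ω * t)) ≤ Real.cos (k0 * h) * Real.exp (-(ω * t)) +
      (Real.exp (-(ω * (t + h))) + Real.exp (-(ω * (t - h)))) / 2 := by
  have hE : 0 < Real.exp (-(ω * t)) := Real.exp_pos _
  have h1 : Real.exp (-(ω * (t + h))) = Real.exp (-(ω * t)) * Real.exp (-(ω * h)) := by
    rw [← Real.exp_add]; congr 1; ring
  have h2 : Real.exp (-(ω * (t - h))) = Real.exp (-(ω * t)) * Real.exp (ω * h) := by
    rw [← Real.exp_add]; congr 1; ring
  have hcos : 1 - (k0 * h) ^ 2 / 2 ≤ Real.cos (k0 * h) := Real.one_sub_sq_div_two_le_cos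
  have hcosh : 1 + (ω * h) ^ 2 / 2 ≤ Real.cosh (ω * h) := by
    -- first two terms of the power series (cf. `DeBruijn1950.one_add_sq_div_two_le_cosh`)
    have hs := sum_le_hasSum (Finset.range 2)
      (fun n _ ↦ div_nonneg (by rw [pow_mul]; positivity) (Nat.cast_nonneg _)) (Real.hasSum_cosh (ω * h))
    simpa [Finset.sum_range_succ, Nat.factorial] using hs
  have hcosh' : Real.cosh (ω * h) = (Real.exp (ω * h) + Real.exp (-(ω * h))) / 2 := Real.cosh_eq _
  have hω : 0 ≤ ω := le_trans (abs_nonneg _) hk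
  have hsq : (k0 * h) ^ 2 ≤ (ω * h) ^ 2 := by
    rw [mul_pow, mul_pow]
    apply mul_le_mul_of_nonneg_right _ (sq_nonneg _)
    exact sq_le_sq' (by linarith [neg_abs_le k0]) (le_trans (le_abs_self _) hk)
  have hbr : 0 ≤ Real.cos (k0 * h) + (Real.exp (-(ω * h)) + Real.exp (ω * h)) / 2 - 2 := by
    have : (Real.exp (-(ω * h)) + Real.exp (ω * h)) / 2 = Real.cosh (ω * h) := by rw [hcosh']; ring
    rw [this]; linarith
  rw [h1, h2]
  nlinarith [mul_nonneg hE.le hbr]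

/-- **Light-cone second-difference inequality.** If a positive measure `μ` on `ℝ² × ℝ` carried by the closed forward
cone `{ω ≥ ‖k‖}` has `e^{-ω(t-h)}` integrable (`0 ≤ h < t`), then the Källén–Lehmann integrals satisfy
`2 ∫ e^{-ω|t|} dμ ≤ ∫ cos(k₀ h) e^{-ω|t|} dμ + (∫ e^{-ω|t+h|} dμ + ∫ e^{-ω|t-h|} dμ)/2`; for a kernel
`K(w, t) = ∫ cos(k·w) e^{-ω|t|} dμ` this reads `2K(0,t) ≤ K(h e₀, t) + (K(0,t+h) + K(0,t-h))/2` — a transverse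
step of length `h` costs at most a time step of length `h` ("speed of light ≤ 1" in real-variable form). [folklore] -/
theorem lightCone_secondDifference (μ : Measure (EuclideanSpace ℝ (Fin 2) × ℝ))
    (hμ : μ {p : EuclideanSpace ℝ (Fin 2) × ℝ | p.2 < ‖p.1‖} = 0) {t h : ℝ} (hh : 0 ≤ h) (hht : h < t)
    (hint : Integrable (fun p : EuclideanSpace ℝ (Fin 2) × ℝ => Real.exp (-(p.2 * |t - h|))) μ) :
    2 * ∫ p, Real.exp (-(p.2 * |t|)) ∂μ ≤
      (∫ p, Real.cos (p.1 0 * h) * Real.exp (-(p.2 * |t|)) ∂μ) +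
        ((∫ p, Real.exp (-(p.2 * |t + h|)) ∂μ) + (∫ p, Real.exp (-(p.2 * |t - h|)) ∂μ)) / 2 := by
  have hae : ∀ᵐ p ∂μ, ‖p.1‖ ≤ p.2 := by
    have h0 := measure_eq_zero_iff_ae_notMem.1 hμ
    filter_upwards [h0] with p hp
    simpa [Set.mem_setOf_eq, not_lt] using hp
  have ht : 0 < t := lt_of_le_of_lt hh hht
  have habs_t : |t| = t := abs_of_pos ht
  have habs_p : |t + h| = t + h := abs_of_pos (by linarith)
  have habs_m : |t - h| = t - h := abs_of_pos (by linarith)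
  have hdom : ∀ p : EuclideanSpace ℝ (Fin 2) × ℝ, ‖p.1‖ ≤ p.2 → ∀ s : ℝ, t - h ≤ s →
      Real.exp (-(p.2 * s)) ≤ Real.exp (-(p.2 * (t - h))) := by
    intro p hp s hs
    have hω : 0 ≤ p.2 := le_trans (norm_nonneg _) hp
    exact Real.exp_le_exp.2 (by nlinarith)
  have hint_t : Integrable (fun p : EuclideanSpace ℝ (Fin 2) × ℝ => Real.exp (-(p.2 * |t|))) μ := by
    refine hint.mono' (by fun_prop) ?_
    filter_upwards [hae] with p hp
    rw [Real.norm_eq_abs, abs_of_pos (Real.exp_pos _), habs_t, habs_m]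
    exact hdom p hp t (by linarith)
  have hint_p : Integrable (fun p : EuclideanSpace ℝ (Fin 2) × ℝ => Real.exp (-(p.2 * |t + h|))) μ := by
    refine hint.mono' (by fun_prop) ?_
    filter_upwards [hae] with p hp
    rw [Real.norm_eq_abs, abs_of_pos (Real.exp_pos _), habs_p, habs_m]
    exact hdom p hp (t + h) (by linarith)
  have hint_c : Integrable (fun p : EuclideanSpace ℝ (Fin 2) × ℝ =>
      Real.cos (p.1 0 * h) * Real.exp (-(p.2 * |t|))) μ := by
    refine hint_t.mono' (by fun_prop) ?_
    filter_upwards with p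
    rw [norm_mul, Real.norm_eq_abs, Real.norm_eq_abs, abs_of_pos (Real.exp_pos _)]
    exact mul_le_of_le_one_left (Real.exp_pos _).le (Real.abs_cos_le_one _)
  have key : 0 ≤ ∫ p, ((Real.cos (p.1 0 * h) * Real.exp (-(p.2 * |t|)) +
      (Real.exp (-(p.2 * |t + h|)) + Real.exp (-(p.2 * |t - h|))) / 2) -
      2 * Real.exp (-(p.2 * |t|))) ∂μ := by
    apply integral_nonneg_of_ae
    filter_upwards [hae] with p hp
    rw [Pi.zero_apply, sub_nonneg, habs_t, habs_p, habs_m]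
    exact pointwise_lightCone h (le_trans (by simpa using PiLp.norm_apply_le p.1 0) hp)
  have hI3 : Integrable (fun p : EuclideanSpace ℝ (Fin 2) × ℝ =>
      (Real.exp (-(p.2 * |t + h|)) + Real.exp (-(p.2 * |t - h|))) / 2) μ := (hint_p.add hint).div_const 2
  have hI1 : Integrable (fun p : EuclideanSpace ℝ (Fin 2) × ℝ =>
      Real.cos (p.1 0 * h) * Real.exp (-(p.2 * |t|)) +
        (Real.exp (-(p.2 * |t + h|)) + Real.exp (-(p.2 * |t - h|))) / 2) μ := hint_c.add hI3
  have hI2 : Integrable (fun p : EuclideanSpace ℝ (Fin 2) × ℝ => 2 * Real.exp (-(p.2 * |t|))) μ :=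
    hint_t.const_mul 2
  rw [integral_sub hI1 hI2, integral_add hint_c hI3, integral_div, integral_add hint_p hint,
    integral_const_mul] at key
  linarith


/-- **Any μ representing the squashed kernel in the `e₂` frame violates the light cone.**  No positive measure on
`ℝ² × ℝ` carried by `{ω ≥ ‖k‖}` represents `(a² + b² + t²/4)^{-1/2}`: the light-cone second-difference inequality at
`t = 1`, `h = 3/10` would give `4 ≤ 10/√34 + 200/91 ≈ 3.9128`. [folklore] -/
theorem no_unitCone_measure_for_Ksq (μ : Measure (EuclideanSpace ℝ (Fin 2) × ℝ))
    (hμ : μ {p : EuclideanSpace ℝ (Fin 2) × ℝ | p.2 < ‖p.1‖} = 0)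
    (hrep : ∀ t a b : ℝ, t ≠ 0 → (Real.sqrt (a ^ 2 + b ^ 2 + t ^ 2 / 4))⁻¹ =
      ∫ p, Real.cos (p.1 0 * a + p.1 1 * b) * Real.exp (-(p.2 * |t|)) ∂μ) : False := by
  have H1 := hrep 1 (3 / 10) 0 one_ne_zero
  have H2 := hrep 1 0 0 one_ne_zero
  have H3 := hrep (1 + 3 / 10) 0 0 (by norm_num)
  have H4 := hrep (1 - 3 / 10) 0 0 (by norm_num)
  simp only [mul_zero, add_zero, Real.cos_zero, one_mul] at H1 H2 H3 H4
  -- axis values: (√(s²/4))⁻¹ = 2/s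
  have hax : ∀ s : ℝ, 0 < s → (Real.sqrt (0 ^ 2 + 0 ^ 2 + s ^ 2 / 4))⁻¹ = 2 / s := by
    intro s hs
    rw [show (0:ℝ) ^ 2 + 0 ^ 2 + s ^ 2 / 4 = (s / 2) ^ 2 by ring, Real.sqrt_sq (by positivity)]
    field_simp
  rw [hax 1 one_pos] at H2
  rw [hax _ (by norm_num)] at H3 H4
  -- integrability of e^{-ω|1 - 3/10|} from the representation (the Bochner integral of a non-integrable
  -- function is 0 ≠ 2/(7/10))
  have hint : Integrable (fun p : EuclideanSpace ℝ (Fin 2) × ℝ => Real.exp (-(p.2 * |1 - 3 / 10|))) μ := by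
    by_contra hni
    rw [integral_undef hni] at H4
    norm_num at H4
  have key := lightCone_secondDifference μ hμ (by norm_num : (0:ℝ) ≤ 3 / 10) (by norm_num : (3:ℝ) / 10 < 1) hint
  rw [← H1, ← H2, ← H3, ← H4] at key
  -- numerics: (√(9/100 + 1/4))⁻¹ < 164/91
  have hs : (91 : ℝ) / 164 < Real.sqrt ((3 / 10) ^ 2 + 0 ^ 2 + 1 ^ 2 / 4) := by
    rw [Real.lt_sqrt (by norm_num)]
    norm_num
  have hinv : (Real.sqrt ((3 / 10) ^ 2 + 0 ^ 2 + 1 ^ 2 / 4))⁻¹ < ((91 : ℝ) / 164)⁻¹ :=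
    inv_strictAnti₀ (by norm_num) hs
  norm_num at hinv key
  linarith

/-- **LOAD-BEARING ANALYSIS: any proof of `UnitSpeedTwoPoint` must use the Ising input `hlim`.**  The statement
of the crux with `ρ`, `hρ`, `hlim` deleted and every other hypothesis and the two-frame conclusion verbatim is false.
Witness (built locally, no definition enters `Summits/`): the squashed free field, `S 2 (x, y) = K (y - x)` off the
diagonal with `K z = (z₀² + z₁² + z₂²/4)^{-1/2}` (speed of light `1/2` along `e₂`), all other entries `0`; it is
normalised, non-degenerate, translation invariant and scale covariant with `Δ = 1/2`, yet its `e₂`-frame kernel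
`(a² + b² + t²/4)^{-1/2}` has no unit-cone Källén–Lehmann measure (`no_unitCone_measure_for_Ksq`).
[cite: GlimmJaffe1987, §6.2] -/
theorem unitSpeedTwoPoint_false_without_hlim :
    ¬ ∀ (Δ : ℝ) (S : Literature.Probability.LatticeModels.CorrFamily 3), (∀ n z, z ∉ Literature.Probability.LatticeModels.NonCoincident 3 n → S n z = 0) → Literature.Probability.LatticeModels.IsNondegenerateTwoPoint S → Literature.Probability.LatticeModels.IsTranslationInvariant S → Literature.Probability.LatticeModels.IsScaleCovariant Δ S → (∃ μ : MeasureTheory.Measure (EuclideanSpace ℝ (Fin 2) × ℝ), μ {p : EuclideanSpace ℝ (Fin 2) × ℝ | p.2 < ‖p.1‖} = 0 ∧ (∀ t a b : ℝ, t ≠ 0 → (fun x : EuclideanSpace ℝ (Fin 3) => S 2 ![0, x]) (EuclideanSpace.single 0 a + EuclideanSpace.single 1 b + EuclideanSpace.single 2 t) = ∫ p, Real.cos (p.1 0 * a + p.1 1 * b) * Real.exp (-(p.2 * |t|)) ∂μ)) ∧ (∃ μ : MeasureTheory.Measure (EuclideanSpace ℝ (Fin 2) × ℝ), μ {p : EuclideanSpace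 ℝ (Fin 2) × ℝ | p.2 < ‖p.1‖} = 0 ∧ (∀ t u v : ℝ, t ≠ 0 → (fun x : EuclideanSpace ℝ (Fin 3) => S 2 ![0, x]) (EuclideanSpace.single 0 ((t + u) / Real.sqrt 2) + EuclideanSpace.single 1 ((t - u) / Real.sqrt 2) + EuclideanSpace.single 2 v) = ∫ p, Real.cos (p.1 0 * u + p.1 1 * v) * Real.exp (-(p.2 * |t|)) ∂μ)) := by
  intro h
  -- the squashed kernel and the witness family (local definitions)
  set K : EuclideanSpace ℝ (Fin 3) → ℝ := fun x => (Real.sqrt (x 0 ^ 2 + x 1 ^ 2 + x 2 ^ 2 / 4))⁻¹ with hK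
  set S : CorrFamily 3 := fun n z =>
    if hn : n = 2 then (if z ⟨0, by omega⟩ = z ⟨1, by omega⟩ then 0 else K (z ⟨1, by omega⟩ - z ⟨0, by omega⟩))
    else 0 with hS
  have S_two : ∀ z : Fin 2 → EuclideanSpace ℝ (Fin 3), S 2 z = if z 0 = z 1 then 0 else K (z 1 - z 0) := by
    intro z; simp [hS]
  have S_ne : ∀ {n : ℕ}, n ≠ 2 → ∀ z : Fin n → EuclideanSpace ℝ (Fin 3), S n z = 0 := by
    intro n hn z; simp [hS, hn]
  have K_smul : ∀ {c : ℝ}, 0 < c → ∀ x : EuclideanSpace ℝ (Fin 3), K (c • x) = c⁻¹ * K x := by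
    intro c hc x
    simp only [hK, PiLp.smul_apply, smul_eq_mul]
    have : (c * x 0) ^ 2 + (c * x 1) ^ 2 + (c * x 2) ^ 2 / 4 = c ^ 2 * (x 0 ^ 2 + x 1 ^ 2 + x 2 ^ 2 / 4) := by
      ring
    rw [this, Real.sqrt_mul (sq_nonneg c), Real.sqrt_sq hc.le, mul_inv]
  have K_pos : ∀ {x : EuclideanSpace ℝ (Fin 3)}, x ≠ 0 → 0 < K x := by
    intro x hx
    simp only [hK]
    apply inv_pos.2
    apply Real.sqrt_pos.2
    by_contra hle
    push Not at hle
    have h0 : x 0 = 0 := by nlinarith [sq_nonneg (x 0), sq_nonneg (x 1), sq_nonneg (x 2)]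
    have h1 : x 1 = 0 := by nlinarith [sq_nonneg (x 0), sq_nonneg (x 1), sq_nonneg (x 2)]
    have h2 : x 2 = 0 := by nlinarith [sq_nonneg (x 0), sq_nonneg (x 1), sq_nonneg (x 2)]
    apply hx
    ext i
    fin_cases i <;> simp [h0, h1, h2]
  -- the four model-blind hypotheses of the crux
  have hnorm : ∀ n z, z ∉ NonCoincident 3 n → S n z = 0 := by
    intro n z hz
    by_cases hn : n = 2
    · subst hn
      rw [mem_nonCoincident, Literature.Barriers.CriticalPhenomena.ScaleNotMoebius.injective_fin_two_iff,
        not_not] at hz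
      rw [S_two, if_pos hz]
    · exact S_ne hn z
  have hnd : IsNondegenerateTwoPoint S := by
    intro z hz
    rw [mem_nonCoincident, Literature.Barriers.CriticalPhenomena.ScaleNotMoebius.injective_fin_two_iff] at hz
    rw [S_two, if_neg hz]
    exact K_pos (sub_ne_zero.2 (Ne.symm hz))
  have htr : IsTranslationInvariant S := by
    intro n v z
    by_cases hn : n = 2
    · subst hn
      simp only [S_two, add_left_inj, add_sub_add_right_eq_sub]
    · simp [S_ne hn]
  have hsc : IsScaleCovariant (1 / 2) S := by
    intro n c hc z
    by_cases hn : n = 2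
    · subst hn
      have hexp : c ^ (-((2 : ℕ) : ℝ) * (1 / 2)) = c⁻¹ := by
        rw [show (-((2 : ℕ) : ℝ) * (1 / 2)) = -1 by norm_num, Real.rpow_neg_one]
      simp only [S_two, hexp]
      by_cases hz : z 0 = z 1
      · simp [hz]
      · have hcz : c • z 0 ≠ c • z 1 := fun h' => hz (smul_right_injective _ hc.ne' h')
        rw [if_neg hcz, if_neg hz, ← smul_sub, K_smul hc]
    · simp [S_ne hn]
  -- the axis-frame values of the witness
  have S_axis : ∀ a b t : ℝ, t ≠ 0 →
      S 2 ![0, EuclideanSpace.single 0 a + EuclideanSpace.single 1 b + EuclideanSpace.single 2 t] =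
        (Real.sqrt (a ^ 2 + b ^ 2 + t ^ 2 / 4))⁻¹ := by
    intro a b t ht
    set p : EuclideanSpace ℝ (Fin 3) :=
      EuclideanSpace.single 0 a + EuclideanSpace.single 1 b + EuclideanSpace.single 2 t with hp
    have h0 : p 0 = a := by simp [hp]
    have h1 : p 1 = b := by simp [hp]
    have h2 : p 2 = t := by simp [hp]
    have hp0 : p ≠ 0 := by
      intro h'
      rw [h'] at h2
      exact ht (by simpa using h2.symm)
    rw [S_two]
    simp only [Matrix.cons_val_zero, Matrix.cons_val_one]
    rw [if_neg (Ne.symm hp0), sub_zero, hK]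
    simp only [h0, h1, h2]
  -- the e₂-frame clause of the conclusion is violated
  obtain ⟨⟨μ, hμ, hrep⟩, -⟩ := h (1 / 2) S hnorm hnd htr hsc
  refine no_unitCone_measure_for_Ksq μ hμ fun t a b ht => ?_
  have := hrep t a b ht
  simp only [] at this
  rw [S_axis a b t ht] at this
  exact this

end Summit.CriticalPhenomena.Ising3DConformalLimit.Theorems.UnitSpeedTwoPoint.Negative

end
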